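/-
# `Balaban1983to89.B5SupH128Torus` — Bałaban CMP 95 (1984): the leaf (1.128) IN ITS PRINTED SUP-NORM CURRENCY for the operator
# `Δ_a` of record on the torus `T_η` (the sup carrier of record of the S1 walk: `Idx n M → ℝ`, `G`, `Δ_a`, `h_z`, `∇`, (1.71), (1.118))

statement-level skeleton of published theorems with citation tags; proofs where landed; nothing here is a claim
about the Yang–Mills mass gap

CITATION HEADER (lean-in-tree rule).  Cell `lit-balaban`, unit `lit-balaban-r02` (reader/typer r02 gen 11 = fold owner of
block B5), HOME `run/shared/lean/pub/lit-balaban/` (SKELETON rows B5.Eq1.128, B5.Eq1.121, B5.Eq1.118–1.119, B5.Eq1.71 cells;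
B5.Prop1.2 "S1-torus programme" file 2; owner r02).  B5 = T. Bałaban, *Propagators and renormalization transformations for
lattice gauge theories. I*, Commun. Math. Phys. **95** (1984) 17–40 [`Balaban1984PropagatorsI`], held as
`paper:balaban1984-cmp95-propagators-rt-i` (journal page = PDF page + 16; pp. 35–38 = text layer p0019–p0022, re-read this
session).  File 2 of the sup-currency torus instantiation of r02's `B5SupWalkS1.SupRealisation` (file 1 = `B5SupCommutator128`,
the `ℓ^∞` schema); the SUP TWIN of seat p38's `B5WalkH128Torus` (p310676, the `L²` currency of (1.114)), whose norm-free
lattice calculus is CITED BY NAME — the one-axis Leibniz identity `commR_axis_apply` ((1.121)), the multiplier estimates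
`abs_gz_nb_sub_le`/`abs_gz_pb_sub_le`/`abs_gz_second_diff_le`/`abs_gz_sub_le` (first differences of `h` of size `O(M₀⁻¹)`,
second differences `O(M₀⁻²)`, uniformly in η — our shorthand; print has «the small factor O(M₀⁻¹)», p. 38), the split
`DeltaAR_eq_Lloc_add_kmat` (`Δ_a = (Δ + aQ*Q) + (−re ∂P∂*)`), the range `distU_le_of_Lloc_ne_zero`, the decay
`abs_liftK_kmat_le`, the row sums `rowsum_le` and the constant `thetaW` — only the NORM READINGS change (sup instead of `L²`).

WHAT IS PRINTED.  p. 35 [PDF 19] L16–18, verbatim: «To formulate them we have to introduce several norms. The most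
fundamental are the supremum norm |A| = max_μ sup_x |A_μ(x)|, |∇A| = max_{μ,ν} sup_x |(∂_μA_ν)(x)|, (1.108)» (the display as
typed in `B5.lean`/`LatticeNorms`; v1.1: the v1.0 line here put a paraphrase ("We will use the norms …") inside
guillemets — QUOTE-AUDIT-B5 item A4, r05 SECOND-READ-B5 pass 25; guillemets in this file = verbatim print only).
p. 37 [PDF 21] (1.121): «Δ_a hA = … = hΔ_aA − K(h)A» with «K(h)A = Σ_b (∂h)(b)(∂A)(b) − (Δh)A + S*(∂h)QA − Q*S(∂h)A + P₁(∂h)A»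
(as quoted in `B5Local114.Kop`).  p. 38 [PDF 22], verbatim: «In the second case we have the small factor O(M₀⁻¹) only,
but we may include the factor exp(−|z′₁ − z′₂|) because |z′₁ − z′₂| ≤ 2d. Defining 2δ₀ = min{⅓δ′₀, M₀⁻¹}, we obtain
|h_{z₁}K(h_{z₂})A| ≤ O(M₀⁻¹)e^{−2δ₀|z₁−z₂|}(|∇A| + |A|). (1.128)».
p. 36 [PDF 20] (1.118): «hence Σ_z h_z²(x) = 1»; p. 30 (1.71): «Δ_a⁻¹ = G_k, or simply G».

WHAT THIS MODULE PROVES (kernel-checked, zero sorry; everything uniform in `η = n⁻¹`, the volume and `M₀ ≥ 1`):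
§1 THE SUP CARRIER OF RECORD: the graded sections `Idx n M → ℝ` (`Idx = (T_η × {1..d}) × Gr d`, p38's index set) with Mathlib's
   sup norm = the printed `|A|`; slices `slS`; the slicewise action of lifted matrices `kerOpS (liftK T)` (`kerOpS_liftK_apply`,
   `kerOpS_liftK_mul`, `kerOpS_liftK_one`); the operators of record `GopS = lift G`, `DAopS = lift Δ_a` with (1.71)
   `DAopS * GopS = GopS * DAopS = 1`; the multipliers `HopS z = h_z` (p38's C^{1,1} profiles `B5WalkPartitionTorus.hz`) with
   (1.118) `Σ_z HopS z * HopS z = 1` (`h118_HopS`) and `‖h_z A‖ ≤ ‖A‖` (`norm_HopS_le` = the field `normH` of `B5SupWalk125.SupModel`);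
§2 THE SUP GRADIENT SIZE MAP `DgS : (Idx → ℝ) →ₗ ((Idx × {1..d}) → ℝ)`, `DgS A ((b,r),ν) = (∇_ν A_r)(b)` with `‖DgS A‖ =
   max_{ν,r,b} |(∇_ν A_r)(b)|` = the printed `|∇A|`; pointwise `|(∇_ν A_r)(b)|, |(∇_νᵀ A_r)(b)| ≤ ‖DgS A‖`;
§3 THE LOCAL BOUND (1.121) IN SUP NORM for `Δ + aQ*Q`, POINTWISE then in norm: `|[h_z, ∇_νᵀ∇_ν]A_r (b)| ≤ 2(Lw/M₀)‖DgS A‖ +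
   (K2/M₀²)‖A‖`, `|[h_z, Δ]A_r(b)| ≤ d·(…)`, `|[h_z, Q*Q]A_r(b)| ≤ 4(Lw/M₀)‖A‖` (row sums of `Q*Q` = 1, range 4 — NO column sums),
   hence **`local_normS_holds`**: `‖[h_z, lift(Δ + aQ*Q)]A‖ ≤ ℓ₁(‖DgS A‖ + ‖A‖)`, `ℓ₁ = (2dLw + dK2 + 4|a|Lw)/M₀` — the SAME
   constant as p38's `L²` `local_norm_holds`;
§4 `schemaS_holds` = `B5SupCommutator128.SchemaS` for the operator of record and **`h128S_holds`**: given the (1.126)-type bound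
   `‖(∂P∂*)_{ij}‖ ≤ Cη^d e^{−δ|x_i−x_j|}` (p16's PROVED `B5PBridgeKernel126.norm_GradOp_PcT_GradOp_adjoint_le_of_pos` supplies it),
   `‖h_{z₁}K(h_{z₂})A‖_∞ ≤ (θ̄(d,a;δ,C)/M₀)·e^{−twoDelta0 δ M₀·dist(ctr z₁, ctr z₂)}·(‖DgS A‖ + ‖A‖)` with p38's `θ̄ = thetaW d a δ C`
   — the field `h128` of `B5SupWalk125.SupModel` / `B5SupWalkS1.Rep` for the sup representation of record, in the PRINTED currency
   of (1.128).

HONEST SCOPE / DIVERGENCE.  (1) As p38's file: (1.126) enters `h128S_holds` as a HYPOTHESIS on the matrix `∂·PcT·∂ᴴ` (discharged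
in the tree by p16's theorem; the packaging into `B5SupWalkS1.Rep.h128`, which quantifies over the (1.126) constants of a
`B5.KernelData`, is file 3's business).  (2) Constants ours (`24/e`, `e^7`, `e^8`, `Lw = 2d·max(sup|h′|,8)`, `K2 = 4·max(sup|h″|,15)`),
print writes O(1)/O(M₀⁻¹); the rate `2δ₀ = min{⅓δ′₀, M₀⁻¹}` is exact.  (3) The sup norm here is over ALL graded components
(vector, 2-tensor, 3-tensor slices alike), which is how the abstract carrier of `B5SupWalkS1.Rep` reads `|·|`; the printed
`max_μ sup_x` is the vector slice.  (4) Cell bookkeeping: rows B5.Eq1.128 / B5.Eq1.121 ("sup currency, operator of record" — cell words),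
B5.Prop1.2 (S1-torus programme file 2) — no head change; value = one located leaf of the printed sup/Hölder walk instantiated,
NOT summit progress.
-/
import Mathlib
import Literature.MathematicalPhysics.QuantumFieldTheory.Balaban1983to89.B5SupCommutator128
import Literature.MathematicalPhysics.QuantumFieldTheory.Balaban1983to89.B5WalkH128Torus

open scoped BigOperators Real Matrix
open Finset Matrix

namespace Literature.MathematicalPhysics.QuantumFieldTheory.Balaban1983to89.B5SupH128Torus

open Literature.MathematicalPhysics.QuantumFieldTheory.Balaban1983to89
open Literature.MathematicalPhysics.QuantumFieldTheory.Balaban1983to89.B5Prop11Plancherel (Tor fine)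
open Literature.MathematicalPhysics.QuantumFieldTheory.Balaban1983to89.B5DeltaA169 (QvAdj)
open Literature.MathematicalPhysics.QuantumFieldTheory.Balaban1983to89.B5Block118 (QvOp)
open Literature.MathematicalPhysics.QuantumFieldTheory.Balaban1983to89.B5Prop12FieldsLattice (distU distU_nonneg)
open Literature.MathematicalPhysics.QuantumFieldTheory.Balaban1983to89.B5Walk131 (twoDelta0)
open Literature.MathematicalPhysics.QuantumFieldTheory.Balaban1983to89.B5CombesThomasLattice (nb QQ_rowsum
  distU_le_four_of_QQ_ne_zero)
open Literature.MathematicalPhysics.QuantumFieldTheory.Balaban1983to89.B5CoverP12Lattice (Lw Lw_nonneg)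
open Literature.MathematicalPhysics.QuantumFieldTheory.Balaban1983to89.B5Local114 (Kop)
open Literature.MathematicalPhysics.QuantumFieldTheory.Balaban1983to89.B5RealFields (fdiffR LapR GR DeltaAR)
open Literature.MathematicalPhysics.QuantumFieldTheory.Balaban1983to89.B5WalkTorusGeom (TorR ucPt Cen ctr)
open Literature.MathematicalPhysics.QuantumFieldTheory.Balaban1983to89.B5WalkPartitionTorus (hz abs_hz_le_one abs_hz_sub_le
  sum_hz_sq dist_ctr_le_of_hz_ne_zero)
open Literature.MathematicalPhysics.QuantumFieldTheory.Balaban1983to89.B5WalkCarrierTorus (Gr Bnd Idx liftK liftK_apply liftK_add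
  hcoef abs_hcoef_le_one)
open Literature.MathematicalPhysics.QuantumFieldTheory.Balaban1983to89.B5WalkH128Torus (pb nb_pb pb_nb fdiffR_mulVec_apply
  fdiffR_transpose_mulVec_apply LapR_eq_sum gz abs_gz_nb_sub_le abs_gz_pb_sub_le abs_gz_second_diff_le abs_gz_sub_le K2 K2_nonneg
  commR commR_apply commR_add commR_smul commR_sum commR_axis_apply QQR abs_QQR_le Lloc distU_le_of_Lloc_ne_zero VC kmat
  abs_liftK_kmat_le rowsum_le thetaW thetaW_nonneg DeltaAR_eq_Lloc_add_kmat dist_ucPt_eq_distU)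
open Literature.MathematicalPhysics.QuantumFieldTheory.Balaban1983to89.B5SupCommutator128 (kerOpS kerOpS_apply mulOpS mulOpS_apply
  mulOpS_mul kerOpS_mul_kerOpS kerOpS_delta kerOpS_add norm_mulOpS_le abs_apply_le_norm SchemaS h128_schemaS)

noncomputable section

variable {d : ℕ}

/-! ## §1 The sup carrier of record: slices, lifted matrices, `G`, `Δ_a`, `h_z`, (1.71), (1.118) -/

section Carrier

variable (n : ℕ) [NeZero n] (M : Fin d → ℕ) [hM : ∀ μ, NeZero (M μ)]

/-- the grade-`r` slice `A_r : T_η × {1..d} → ℝ` of a graded section `A : Idx → ℝ` (sup carrier; p38's `sl` is the `ℓ²` twin).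
[cite: Balaban1984PropagatorsI, (1.108) p.35 (|A| = max_μ sup_x |A_μ(x)|)] -/
def slS (f : Idx n M → ℝ) (r : Gr d) : Bnd n M → ℝ := fun b => f (b, r)

omit [NeZero n] hM in
/-- `slS` unfolds. [cite: Balaban1984PropagatorsI, (1.108) p.35] -/
@[simp] theorem slS_apply (f : Idx n M → ℝ) (r : Gr d) (b : Bnd n M) : slS n M f r b = f (b, r) := rfl

/-- **the lift acts slicewise on the sup carrier**: `(lift T · A)(b, r) = (T · A_r)(b)`.
[cite: Balaban1984PropagatorsI, (1.123) p.37 (G, h_z, K(h_z) act on vector functions)] -/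
theorem kerOpS_liftK_apply (T : Matrix (Bnd n M) (Bnd n M) ℝ) (f : Idx n M → ℝ) (p : Idx n M) :
    kerOpS (liftK n M T) f p = (T *ᵥ slS n M f p.2) p.1 := by
  rw [kerOpS_apply, Fintype.sum_prod_type, Matrix.mulVec, dotProduct]
  refine Finset.sum_congr rfl fun b _ => ?_
  simp only [liftK_apply, ite_mul, zero_mul]
  rw [Finset.sum_ite_eq Finset.univ p.2]
  simp [slS]

/-- **lifting is multiplicative on the sup carrier**: `lift T ∘ lift T′ = lift (TT′)`. [cite: Balaban1984PropagatorsI, (1.71) p.30] -/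
theorem kerOpS_liftK_mul (T T' : Matrix (Bnd n M) (Bnd n M) ℝ) :
    kerOpS (liftK n M T) * kerOpS (liftK n M T') = kerOpS (liftK n M (T * T')) := by
  rw [kerOpS_mul_kerOpS]
  congr 1
  funext p q
  rw [Fintype.sum_prod_type]
  simp only [liftK_apply, Matrix.mul_apply]
  by_cases h : p.2 = q.2
  · rw [if_pos h]
    refine Finset.sum_congr rfl fun b _ => ?_
    rw [Finset.sum_eq_single p.2]
    · simp [h]
    · intro r _ hr
      rw [if_neg (Ne.symm hr), zero_mul]
    · intro hp; exact absurd (Finset.mem_univ _) hp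
  · rw [if_neg h]
    refine Finset.sum_eq_zero fun b _ => Finset.sum_eq_zero fun r _ => ?_
    by_cases h1 : p.2 = r
    · subst h1; rw [if_neg h, mul_zero]
    · rw [if_neg h1, zero_mul]

/-- **lifting the identity gives the identity** on the sup carrier. [cite: Balaban1984PropagatorsI, (1.71) p.30] -/
theorem kerOpS_liftK_one : kerOpS (liftK n M (1 : Matrix (Bnd n M) (Bnd n M) ℝ)) = 1 := by
  classical
  rw [← kerOpS_delta]
  congr 1
  funext p q
  simp only [liftK_apply, Matrix.one_apply]
  by_cases h : p = q
  · subst h; simp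
  · rw [if_neg h]
    by_cases h2 : p.2 = q.2
    · rw [if_pos h2, if_neg]
      intro h1
      exact h (Prod.ext h1 h2)
    · rw [if_neg h2]

variable (a : ℝ)

/-- **`G = Δ_a⁻¹` on the sup carrier** (slicewise pv15's real matrix `GR = re((DeltaA n M a)⁻¹)`).
[cite: Balaban1984PropagatorsI, (1.71) p.30 («Δ_a⁻¹ = G_k, or simply G»)] -/
def GopS : Module.End ℝ (Idx n M → ℝ) := kerOpS (liftK n M (GR n M a))

/-- **`Δ_a` on the sup carrier** (slicewise `DeltaAR = re(DeltaA n M a)`, r02's `Δ − ∂P∂* + aQ*Q`).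
[cite: Balaban1984PropagatorsI, (1.69) p.29, (1.73) p.30] -/
def DAopS : Module.End ℝ (Idx n M → ℝ) := kerOpS (liftK n M (DeltaAR n M a))

variable {n M a}

/-- **(1.71) `Δ_a G = 1`** on the sup carrier (the field `h71` of `B5SupWalkS1.Rep`). [cite: Balaban1984PropagatorsI, (1.71) p.30] -/
theorem DAopS_mul_GopS (hn : 1 ≤ n) (ha : 0 < a) : DAopS n M a * GopS n M a = 1 := by
  rw [DAopS, GopS, kerOpS_liftK_mul, B5RealFields.DeltaAR_mul_GR n hn M a ha, kerOpS_liftK_one]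

/-- **(1.71) `G Δ_a = 1`** on the sup carrier (the field `h71'`). [cite: Balaban1984PropagatorsI, (1.71) p.30] -/
theorem GopS_mul_DAopS (hn : 1 ≤ n) (ha : 0 < a) : GopS n M a * DAopS n M a = 1 := by
  rw [DAopS, GopS, kerOpS_liftK_mul, B5RealFields.GR_mul_DeltaAR n hn M a ha, kerOpS_liftK_one]

variable (n M) (M₀ : ℕ)

/-- **the multiplier `h_z`** on the sup carrier (p38's coefficient function `hcoef` of the C^{1,1} product profiles).
[cite: Balaban1984PropagatorsI, (1.118)–(1.119) p.36] -/
def HopS (z : Cen M M₀) : Module.End ℝ (Idx n M → ℝ) := mulOpS (hcoef n M M₀ z)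

variable {n M M₀}

omit [NeZero n] hM in
/-- `HopS` unfolds. [cite: Balaban1984PropagatorsI, (1.118) p.36] -/
theorem HopS_eq (z : Cen M M₀) : HopS n M M₀ z = mulOpS (hcoef n M M₀ z) := rfl

/-- **partition of unity as operators**: `Σ_z a_z(i)² = 1` for all `i` gives `Σ_z mulOpS (a z) * mulOpS (a z) = 1` on `ℓ^∞(ι)`.
[cite: Balaban1984PropagatorsI, (1.118) p.36 («hence Σ_z h_z²(x) = 1»)] -/
theorem sum_mulOpS_mul_self {ι : Type} {S : Type} [Fintype S] (c : S → ι → ℝ) (h : ∀ i, ∑ z, c z i ^ 2 = 1) :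
    ∑ z, mulOpS (c z) * mulOpS (c z) = 1 := by
  apply LinearMap.ext
  intro v
  funext i
  rw [LinearMap.coe_sum, Finset.sum_apply, Finset.sum_apply]
  simp only [Module.End.mul_apply, mulOpS_apply, Module.End.one_apply]
  have e : ∀ z, c z i * (c z i * v i) = c z i ^ 2 * v i := fun z => by ring
  simp only [e]
  rw [← Finset.sum_mul, h i, one_mul]

omit [NeZero n] hM in
/-- **(1.118) `Σ_z h_z h_z = 1`** on the sup carrier — the field `h118` of `B5SupWalkS1.Rep`.
[cite: Balaban1984PropagatorsI, (1.118) p.36 («hence Σ_z h_z²(x) = 1»)] -/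
theorem h118_HopS : ∑ z : Cen M M₀, HopS n M M₀ z * HopS n M M₀ z = 1 :=
  sum_mulOpS_mul_self (hcoef n M M₀) fun p => sum_hz_sq M M₀ (ucPt M n p.1.1)

/-- **`|h_zA| ≤ |A|`** in sup norm (`0 ≤ h ≤ 1`) — the field `normH` of `B5SupWalk125.SupModel` / `B5SupWalkS1.Rep`.
[cite: Balaban1984PropagatorsI, (1.118) p.36] -/
theorem norm_HopS_le (z : Cen M M₀) (f : Idx n M → ℝ) : ‖HopS n M M₀ z f‖ ≤ ‖f‖ := by
  have h := norm_mulOpS_le (a := hcoef n M M₀ z) zero_le_one (abs_hcoef_le_one z) f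
  rwa [one_mul] at h

end Carrier

/-! ## §2 The sup gradient `|∇A| = max_{ν,μ} sup_x |(∂_νA_μ)(x)|` as a linear size map -/

section Gradient

variable (n : ℕ) [NeZero n] (M : Fin d → ℕ) [hM : ∀ μ, NeZero (M μ)]

/-- **the graded lattice gradient into the sup-normed component space**: `DgS A ((b,r),ν) = (∇_ν A_r)(b)` (pv15's real
difference matrices `fdiffR ν`, lattice factor `η⁻¹`); its sup norm is the printed `|∇A|` (over all graded slices).
[cite: Balaban1984PropagatorsI, (1.108) p.35 (|∇A|), (1.31) p.23, (1.128) p.38] -/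
def DgS : (Idx n M → ℝ) →ₗ[ℝ] (Idx n M × Fin d → ℝ) where
  toFun f := fun q => (fdiffR n M q.2 *ᵥ slS n M f q.1.2) q.1.1
  map_add' f g := by
    funext q
    simp only [Matrix.mulVec, dotProduct, slS, Pi.add_apply, mul_add, Finset.sum_add_distrib]
  map_smul' c f := by
    funext q
    simp only [Matrix.mulVec, dotProduct, slS, Pi.smul_apply, smul_eq_mul, RingHom.id_apply, Finset.mul_sum]
    exact Finset.sum_congr rfl fun j _ => by ring

variable {n M}

/-- `DgS` unfolds. [cite: Balaban1984PropagatorsI, (1.108) p.35] -/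
theorem DgS_apply (f : Idx n M → ℝ) (q : Idx n M × Fin d) :
    DgS n M f q = (fdiffR n M q.2 *ᵥ slS n M f q.1.2) q.1.1 := rfl

/-- **every forward difference is bounded by `|∇A|`**: `|(∇_ν A_r)(b)| ≤ ‖DgS A‖`. [cite: Balaban1984PropagatorsI, (1.108) p.35] -/
theorem abs_fdiffR_slS_le (f : Idx n M → ℝ) (r : Gr d) (ν : Fin d) (b : Bnd n M) :
    |(fdiffR n M ν *ᵥ slS n M f r) b| ≤ ‖DgS n M f‖ :=
  abs_apply_le_norm (DgS n M f) ((b, r), ν)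

/-- **every backward difference is bounded by `|∇A|`**: `|(∇_νᵀ A_r)(b)| = |(∇_ν A_r)(b − e_ν)| ≤ ‖DgS A‖`.
[cite: Balaban1984PropagatorsI, (1.108) p.35, (1.21) p.21 (∂*)] -/
theorem abs_fdiffR_transpose_slS_le (f : Idx n M → ℝ) (r : Gr d) (ν : Fin d) (b : Bnd n M) :
    |((fdiffR n M ν)ᵀ *ᵥ slS n M f r) b| ≤ ‖DgS n M f‖ := by
  have h := abs_fdiffR_slS_le f r ν (pb n M ν b)
  rw [fdiffR_mulVec_apply, nb_pb] at h
  rw [fdiffR_transpose_mulVec_apply]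
  have e : (n : ℝ) * (slS n M f r (pb n M ν b) - slS n M f r b) = -((n : ℝ) * (slS n M f r b - slS n M f r (pb n M ν b))) := by
    ring
  rw [e, abs_neg]
  exact h

/-- every component is bounded by `|A|`: `|A_r(b)| ≤ ‖A‖`. [cite: Balaban1984PropagatorsI, (1.108) p.35] -/
theorem abs_slS_le (f : Idx n M → ℝ) (r : Gr d) (b : Bnd n M) : |slS n M f r b| ≤ ‖f‖ :=
  abs_apply_le_norm f (b, r)

end Gradient

/-! ## §3 The local bound (1.121) in sup norm for `Δ + aQ*Q`: pointwise, then `local_normS_holds` -/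

section Local

variable {n : ℕ} [NeZero n] {M : Fin d → ℕ} [hM : ∀ μ, NeZero (M μ)] {M₀ : ℕ} {a : ℝ}

/-- **the commutator with a lifted matrix, componentwise**: `([h_z, lift T]A)(b, r) = [h_z, T]A_r (b)` (p38's real commutator
`commR`). [cite: Balaban1984PropagatorsI, (1.121) p.37 (K(h) = hΔ_a − Δ_a h), (1.123) p.37 (componentwise action)] -/
theorem comm_liftK_apply (z : Cen M M₀) (T : Matrix (Bnd n M) (Bnd n M) ℝ) (A : Idx n M → ℝ) (p : Idx n M) :
    (mulOpS (hcoef n M M₀ z) * kerOpS (liftK n M T) - kerOpS (liftK n M T) * mulOpS (hcoef n M M₀ z)) A p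
      = commR (gz n M M₀ z) T (slS n M A p.2) p.1 := by
  rw [LinearMap.sub_apply, Pi.sub_apply, Module.End.mul_apply, Module.End.mul_apply, mulOpS_apply, kerOpS_liftK_apply,
    kerOpS_liftK_apply, commR_apply]
  rfl

/-- **THE LAPLACIAN PART, ONE AXIS, POINTWISE** («Σ_b (∂h)(b)(∂A)(b) − (Δh)A» of (1.121)):
`|[h_z, ∇_νᵀ∇_ν]A_r (b)| ≤ 2(Lw/M₀)·|∇A| + (K2/M₀²)·|A|`, uniformly in `η` (by p38's `commR_axis_apply`, first differences of `h` = `O(M₀⁻¹)`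
`abs_gz_nb_sub_le`/`abs_gz_pb_sub_le`, second differences = `O(M₀⁻²)` `abs_gz_second_diff_le`).
[cite: Balaban1984PropagatorsI, (1.121) p.37, (1.128) p.38 («O(M₀⁻¹)… (|∇A| + |A|)»)] -/
theorem abs_commR_axis_le (hn : 1 ≤ n) (hM₀ : 1 ≤ M₀) (z : Cen M M₀) (ν : Fin d) (A : Idx n M → ℝ) (r : Gr d)
    (b : Bnd n M) :
    |commR (gz n M M₀ z) ((fdiffR n M ν)ᵀ * fdiffR n M ν) (slS n M A r) b|
      ≤ 2 * (Lw d / M₀) * ‖DgS n M A‖ + K2 / (M₀ : ℝ) ^ 2 * ‖A‖ := by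
  have hnpos : (0 : ℝ) < n := Nat.cast_pos.mpr (NeZero.pos n)
  have hn0 : (n : ℝ) ≠ 0 := ne_of_gt hnpos
  have hL : 0 ≤ Lw d / M₀ := div_nonneg (Lw_nonneg d) (Nat.cast_nonneg _)
  have hK : 0 ≤ K2 / (M₀ : ℝ) ^ 2 := div_nonneg K2_nonneg (sq_nonneg _)
  set g := gz n M M₀ z with hg
  set v := slS n M A r with hv
  rw [commR_axis_apply]
  -- the three factors of (1.121)
  have f1 : |(n : ℝ) * (g (nb n M ν b) - g b)| ≤ Lw d / M₀ := by
    rw [abs_mul, abs_of_pos hnpos]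
    calc (n : ℝ) * |g (nb n M ν b) - g b| ≤ n * (Lw d / M₀ * (1 / n)) :=
          mul_le_mul_of_nonneg_left (abs_gz_nb_sub_le hn hM₀ z ν b) hnpos.le
      _ = Lw d / M₀ := by field_simp
  have f2 : |(n : ℝ) * (g (pb n M ν b) - g b)| ≤ Lw d / M₀ := by
    rw [abs_mul, abs_of_pos hnpos]
    calc (n : ℝ) * |g (pb n M ν b) - g b| ≤ n * (Lw d / M₀ * (1 / n)) :=
          mul_le_mul_of_nonneg_left (abs_gz_pb_sub_le hn hM₀ z ν b) hnpos.le
      _ = Lw d / M₀ := by field_simp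
  have f3 : |(n : ℝ) ^ 2 * (g (nb n M ν b) - 2 * g b + g (pb n M ν b))| ≤ K2 / (M₀ : ℝ) ^ 2 := by
    rw [abs_mul, abs_of_nonneg (by positivity : (0 : ℝ) ≤ (n : ℝ) ^ 2)]
    calc (n : ℝ) ^ 2 * |g (nb n M ν b) - 2 * g b + g (pb n M ν b)|
        ≤ (n : ℝ) ^ 2 * (K2 / (M₀ : ℝ) ^ 2 * (1 / n) ^ 2) :=
          mul_le_mul_of_nonneg_left (abs_gz_second_diff_le hM₀ z ν b) (by positivity)
      _ = K2 / (M₀ : ℝ) ^ 2 := by field_simp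
  have g1 : |(fdiffR n M ν *ᵥ v) b| ≤ ‖DgS n M A‖ := abs_fdiffR_slS_le A r ν b
  have g2 : |((fdiffR n M ν)ᵀ *ᵥ v) b| ≤ ‖DgS n M A‖ := abs_fdiffR_transpose_slS_le A r ν b
  have g3 : |v b| ≤ ‖A‖ := abs_slS_le A r b
  have hD : 0 ≤ ‖DgS n M A‖ := norm_nonneg _
  have hA : 0 ≤ ‖A‖ := norm_nonneg _
  calc |(n : ℝ) * (g (nb n M ν b) - g b) * (fdiffR n M ν *ᵥ v) b
          + (n : ℝ) * (g (pb n M ν b) - g b) * ((fdiffR n M ν)ᵀ *ᵥ v) b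
          + (n : ℝ) ^ 2 * (g (nb n M ν b) - 2 * g b + g (pb n M ν b)) * v b|
      ≤ |(n : ℝ) * (g (nb n M ν b) - g b) * (fdiffR n M ν *ᵥ v) b|
          + |(n : ℝ) * (g (pb n M ν b) - g b) * ((fdiffR n M ν)ᵀ *ᵥ v) b|
          + |(n : ℝ) ^ 2 * (g (nb n M ν b) - 2 * g b + g (pb n M ν b)) * v b| := abs_add_three _ _ _
    _ ≤ Lw d / M₀ * ‖DgS n M A‖ + Lw d / M₀ * ‖DgS n M A‖ + K2 / (M₀ : ℝ) ^ 2 * ‖A‖ := by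
        rw [abs_mul, abs_mul ((n : ℝ) * _), abs_mul ((n : ℝ) ^ 2 * _)]
        exact add_le_add (add_le_add (mul_le_mul f1 g1 (abs_nonneg _) hL) (mul_le_mul f2 g2 (abs_nonneg _) hL))
          (mul_le_mul f3 g3 (abs_nonneg _) hK)
    _ = _ := by ring

/-- **THE LAPLACIAN PART, POINTWISE**: `|[h_z, Δ]A_r (b)| ≤ d·(2(Lw/M₀)|∇A| + (K2/M₀²)|A|)` (`Δ = Σ_ν ∇_νᵀ∇_ν`, p38's `LapR_eq_sum`).
[cite: Balaban1984PropagatorsI, (1.121) p.37, (1.128) p.38] -/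
theorem abs_commR_LapR_le (hn : 1 ≤ n) (hM₀ : 1 ≤ M₀) (z : Cen M M₀) (A : Idx n M → ℝ) (r : Gr d) (b : Bnd n M) :
    |commR (gz n M M₀ z) (LapR n M) (slS n M A r) b|
      ≤ d * (2 * (Lw d / M₀) * ‖DgS n M A‖ + K2 / (M₀ : ℝ) ^ 2 * ‖A‖) := by
  rw [LapR_eq_sum, commR_sum, Finset.sum_apply]
  calc |∑ ν, commR (gz n M M₀ z) ((fdiffR n M ν)ᵀ * fdiffR n M ν) (slS n M A r) b|
      ≤ ∑ ν, |commR (gz n M M₀ z) ((fdiffR n M ν)ᵀ * fdiffR n M ν) (slS n M A r) b| := Finset.abs_sum_le_sum_abs _ _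
    _ ≤ ∑ _ν : Fin d, (2 * (Lw d / M₀) * ‖DgS n M A‖ + K2 / (M₀ : ℝ) ^ 2 * ‖A‖) :=
        Finset.sum_le_sum fun ν _ => abs_commR_axis_le hn hM₀ z ν A r b
    _ = _ := by rw [Finset.sum_const, Finset.card_univ, Fintype.card_fin, nsmul_eq_mul]

/-- **THE `aQ*Q` PART, POINTWISE** («S*(∂h)QA − Q*S(∂h)A» of (1.121)): `|[h_z, Q*Q]A_r (b)| ≤ 4(Lw/M₀)·|A|` — entries
`(h_z(b) − h_z(b′))(Q*Q)_{bb′}`, range `4`, absolute ROW sums of `Q*Q` equal to `1` (r02/p37's `QQ_rowsum`); the sup currency needs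
no column sums. [cite: Balaban1984PropagatorsI, (1.121) p.37, (1.18) p.20, (1.128) p.38] -/
theorem abs_commR_QQR_le (hn : 1 ≤ n) (hM₀ : 1 ≤ M₀) (z : Cen M M₀) (A : Idx n M → ℝ) (r : Gr d) (b : Bnd n M) :
    |commR (gz n M M₀ z) (QQR n M) (slS n M A r) b| ≤ 4 * (Lw d / M₀) * ‖A‖ := by
  set g := gz n M M₀ z with hg
  set v := slS n M A r with hv
  set k : Bnd n M → Bnd n M → ℝ := fun b j => (g b - g j) * QQR n M b j with hk
  have hL : 0 ≤ Lw d / M₀ := div_nonneg (Lw_nonneg d) (Nat.cast_nonneg _)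
  have hA : 0 ≤ ‖A‖ := norm_nonneg _
  have e : commR g (QQR n M) v b = ∑ j, k b j * v j := by
    simp only [commR, hk, Matrix.mulVec, dotProduct, Finset.mul_sum, ← Finset.sum_sub_distrib]
    exact Finset.sum_congr rfl fun j _ => by ring
  have hent : ∀ j, |k b j| ≤ 4 * (Lw d / M₀) * ‖(QvAdj n M * QvOp n M) b j‖ := by
    intro j
    rw [hk, abs_mul]
    by_cases h0 : (QvAdj n M * QvOp n M) b j = 0
    · have : QQR n M b j = 0 := by
        rw [QQR, B5RealFields.reM_apply, h0, Complex.zero_re]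
      rw [this, h0, abs_zero, mul_zero, norm_zero, mul_zero]
    · have hd := distU_le_four_of_QQ_ne_zero n M h0
      calc |g b - g j| * |QQR n M b j| ≤ (Lw d / M₀ * distU n M b.1 j.1) * ‖(QvAdj n M * QvOp n M) b j‖ :=
            mul_le_mul (abs_gz_sub_le hn hM₀ z b j) (abs_QQR_le b j) (abs_nonneg _) (mul_nonneg hL (distU_nonneg _ _))
        _ ≤ (Lw d / M₀ * 4) * ‖(QvAdj n M * QvOp n M) b j‖ := by gcongr
        _ = _ := by ring
  rw [e]
  calc |∑ j, k b j * v j| ≤ ∑ j, |k b j * v j| := Finset.abs_sum_le_sum_abs _ _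
    _ = ∑ j, |k b j| * |v j| := Finset.sum_congr rfl fun j _ => abs_mul _ _
    _ ≤ ∑ j, 4 * (Lw d / M₀) * ‖(QvAdj n M * QvOp n M) b j‖ * ‖A‖ :=
        Finset.sum_le_sum fun j _ => mul_le_mul (hent j) (abs_slS_le A r j) (abs_nonneg _) (by positivity)
    _ = 4 * (Lw d / M₀) * (∑ j, ‖(QvAdj n M * QvOp n M) b j‖) * ‖A‖ := by
        rw [Finset.mul_sum, Finset.sum_mul]
    _ = 4 * (Lw d / M₀) * ‖A‖ := by rw [QQ_rowsum n M b, mul_one]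

/-- **THE LOCAL BOUND (1.121) FOR `Δ + aQ*Q`, POINTWISE**: `|[h_z, Δ + aQ*Q]A_r (b)| ≤ c₁|∇A| + c₂|A|` with `c₁ = 2dLw/M₀`,
`c₂ = dK2/M₀² + 4|a|Lw/M₀`. [cite: Balaban1984PropagatorsI, (1.121) p.37, (1.128) p.38] -/
theorem abs_commR_Lloc_le (hn : 1 ≤ n) (hM₀ : 1 ≤ M₀) (z : Cen M M₀) (A : Idx n M → ℝ) (r : Gr d) (b : Bnd n M) :
    |commR (gz n M M₀ z) (Lloc n M a) (slS n M A r) b|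
      ≤ d * (2 * (Lw d / M₀)) * ‖DgS n M A‖ + (d * (K2 / (M₀ : ℝ) ^ 2) + |a| * (4 * (Lw d / M₀))) * ‖A‖ := by
  rw [Lloc, commR_add, commR_smul, Pi.add_apply]
  have h1 := abs_commR_LapR_le hn hM₀ z A r b
  have h2 := abs_commR_QQR_le hn hM₀ z A r b
  have h3 : |a * commR (gz n M M₀ z) (QQR n M) (slS n M A r) b| ≤ |a| * (4 * (Lw d / M₀) * ‖A‖) := by
    rw [abs_mul]
    exact mul_le_mul_of_nonneg_left h2 (abs_nonneg a)
  calc _ ≤ |commR (gz n M M₀ z) (LapR n M) (slS n M A r) b| + |a * commR (gz n M M₀ z) (QQR n M) (slS n M A r) b| :=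
        abs_add_le _ _
    _ ≤ d * (2 * (Lw d / M₀) * ‖DgS n M A‖ + K2 / (M₀ : ℝ) ^ 2 * ‖A‖) + |a| * (4 * (Lw d / M₀) * ‖A‖) := add_le_add h1 h3
    _ = _ := by ring

/-- **THE FIELD `SchemaS.local_norm` FOR THE OPERATOR OF RECORD, SUP CURRENCY**: on the graded sup carrier,
`‖[h_z, lift(Δ + aQ*Q)]A‖_∞ ≤ ℓ₁(‖DgS A‖ + ‖A‖)` with `ℓ₁ = (2dLw + 4d·max(sup|h″|,15) + 4|a|Lw)/M₀ = O(M₀⁻¹)`, uniformly in `η` —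
the same constant as p38's `L²` `local_norm_holds`. [cite: Balaban1984PropagatorsI, (1.121) p.37, (1.128) p.38 («the small factor
O(M₀⁻¹) only»)] -/
theorem local_normS_holds (hn : 1 ≤ n) (hM₀ : 1 ≤ M₀) (z : Cen M M₀) (A : Idx n M → ℝ) :
    ‖(mulOpS (hcoef n M M₀ z) * kerOpS (liftK n M (Lloc n M a)) - kerOpS (liftK n M (Lloc n M a)) * mulOpS (hcoef n M M₀ z)) A‖
      ≤ (2 * d * Lw d + d * K2 + 4 * |a| * Lw d) / M₀ * (‖DgS n M A‖ + ‖A‖) := by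
  have hM0 : (0 : ℝ) < M₀ := by exact_mod_cast hM₀
  have hM1 : (1 : ℝ) ≤ M₀ := by exact_mod_cast hM₀
  have hLw := Lw_nonneg d
  have hK2 := K2_nonneg
  set c₁ : ℝ := d * (2 * (Lw d / M₀)) with hc₁
  set c₂ : ℝ := d * (K2 / (M₀ : ℝ) ^ 2) + |a| * (4 * (Lw d / M₀)) with hc₂
  set ℓ₁ : ℝ := (2 * d * Lw d + d * K2 + 4 * |a| * Lw d) / M₀ with hℓ₁
  have hc₁0 : 0 ≤ c₁ := by positivity
  have hc₂0 : 0 ≤ c₂ := by positivity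
  have hℓ0 : 0 ≤ ℓ₁ := by positivity
  have h1 : c₁ ≤ ℓ₁ := by
    rw [hc₁, hℓ₁, le_div_iff₀ hM0]
    have : d * (2 * (Lw d / (M₀ : ℝ))) * M₀ = 2 * d * Lw d := by field_simp
    rw [this]
    have : (0 : ℝ) ≤ d * K2 + 4 * |a| * Lw d := by positivity
    linarith
  have h2 : c₂ ≤ ℓ₁ := by
    rw [hc₂, hℓ₁, le_div_iff₀ hM0]
    have e : (d * (K2 / (M₀ : ℝ) ^ 2) + |a| * (4 * (Lw d / M₀))) * M₀ = d * K2 / M₀ + 4 * |a| * Lw d := by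
      field_simp
    rw [e]
    have h3 : d * K2 / (M₀ : ℝ) ≤ d * K2 := div_le_self (by positivity) hM1
    have h4 : (0 : ℝ) ≤ 2 * d * Lw d := by positivity
    linarith
  have hD := norm_nonneg (DgS n M A)
  have hA := norm_nonneg A
  refine (pi_norm_le_iff_of_nonneg (by positivity)).mpr fun p => ?_
  rw [Real.norm_eq_abs, comm_liftK_apply]
  calc _ ≤ c₁ * ‖DgS n M A‖ + c₂ * ‖A‖ := abs_commR_Lloc_le hn hM₀ z A p.2 p.1
    _ ≤ ℓ₁ * ‖DgS n M A‖ + ℓ₁ * ‖A‖ := add_le_add (mul_le_mul_of_nonneg_right h1 hD) (mul_le_mul_of_nonneg_right h2 hA)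
    _ = ℓ₁ * (‖DgS n M A‖ + ‖A‖) := by ring

end Local

/-! ## §4 The schema assembled: `h128` in the printed sup currency for the operator of record -/

section H128

variable {n : ℕ} [NeZero n] {M : Fin d → ℕ} [hM : ∀ μ, NeZero (M μ)] {a : ℝ}

/-- `Δ_a` on the sup carrier splits: `DAopS = kerOpS (lift(Δ + aQ*Q)) + kerOpS (lift(−re ∂P∂*))` (p38's `DeltaAR_eq_Lloc_add_kmat`).
[cite: Balaban1984PropagatorsI, (1.69) p.29, (1.121) p.37] -/
theorem DAopS_eq_split : DAopS n M a = kerOpS (liftK n M (Lloc n M a)) + kerOpS (liftK n M (kmat n M)) := by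
  rw [DAopS, DeltaAR_eq_Lloc_add_kmat, liftK_add, kerOpS_add]

/-- **THE SUP-NORM SCHEMA `B5SupCommutator128.SchemaS` INSTANTIATED FOR THE OPERATOR OF RECORD** (profiles `h_z` of
`B5WalkPartitionTorus`, exact centres, `s = ⅔M₀`, `ℓ = Lw/M₀`, `ℓ₁ = (2dLw + dK2 + 4|a|Lw)/M₀`, `ρ = 4`, kernel constant `Cη^d`, row
sums `|Gr d|·d·η^{−d}e^{δ/4}K_d(δ/8)`; size map `DgS`). [cite: Balaban1984PropagatorsI, (1.121) p.37, (1.126) p.38, (1.128) p.38] -/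
theorem schemaS_holds (hn : 1 ≤ n) {M₀ : ℕ} (hM₀ : 1 ≤ M₀) {δ C : ℝ} (hδ : 0 < δ) (hC : 0 ≤ C)
    (hV : ∀ i j : Bnd n M, ‖VC n M i j‖ ≤ C * ((n : ℝ) ^ d)⁻¹ * Real.exp (-(δ * distU n M i.1 j.1))) :
    SchemaS (fun p : Idx n M => ucPt M n p.1.1) (hcoef n M M₀) (ctr M M₀) (liftK n M (Lloc n M a)) (liftK n M (kmat n M))
      (DgS n M) (2 / 3 * M₀) (Lw d / M₀) ((2 * d * Lw d + d * K2 + 4 * |a| * Lw d) / M₀) 4 (C * ((n : ℝ) ^ d)⁻¹) δ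
      (Fintype.card (Gr d) * (d * ((n : ℝ) ^ d * (Real.exp (2 * (δ / 8)) * B4Sect5Proof.latticeConst d (δ / 8))))) where
  abs_le := fun z p => abs_hcoef_le_one z p
  supp := fun z p h => dist_ctr_le_of_hz_ne_zero M hM₀ h
  lip := fun z p q => abs_hz_sub_le M hM₀ z _ _
  lip_nonneg := div_nonneg (Lw_nonneg d) (Nat.cast_nonneg _)
  range := by
    intro p q hfar
    rw [liftK_apply]
    split_ifs with h
    · by_contra hne
      have h4 := distU_le_of_Lloc_ne_zero hn hne
      rw [dist_ucPt_eq_distU hn] at hfar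
      linarith
    · rfl
  local_norm := fun z A => local_normS_holds hn hM₀ z A
  loc_nonneg := by
    have := Lw_nonneg d
    have := K2_nonneg
    positivity
  decay := abs_liftK_kmat_le hn hC hV
  C_nonneg := by positivity
  δ_pos := hδ
  rowsum := fun p => rowsum_le hn (by positivity) p

/-- **THE FIELD `h128` OF `B5SupWalkS1.Rep` / `B5SupWalk125.SupModel` FOR THE OPERATOR `Δ_a` OF RECORD, IN THE PRINTED SUP CURRENCY**
(«|h_{z₁}K(h_{z₂})A| ≤ O(M₀⁻¹)e^{−2δ₀|z₁−z₂|}(|∇A| + |A|). (1.128)», `2δ₀ = min{⅓δ′₀, M₀⁻¹}`): given the (1.126)-type bound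
`‖(∂P∂*)_{ij}‖ ≤ Cη^d e^{−δ|x_i−x_j|}` (p16's `norm_GradOp_PcT_GradOp_adjoint_le_of_pos`), for all centres `z₁ z₂` and all `A` of the
graded sup carrier, `‖h_{z₁}K(h_{z₂})A‖_∞ ≤ (θ̄(d,a;δ,C)/M₀)·e^{−twoDelta0 δ M₀·dist(ctr z₁, ctr z₂)}·(‖DgS A‖_∞ + ‖A‖_∞)` with p38's
`θ̄ = thetaW d a δ C`, uniformly in `η`, the volume and `M₀ ≥ 1`. [cite: Balaban1984PropagatorsI, (1.128) p.38, (1.121) p.37, (1.126) p.38] -/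
theorem h128S_holds (hn : 1 ≤ n) {M₀ : ℕ} (hM₀ : 1 ≤ M₀) {δ C : ℝ} (hδ : 0 < δ) (hC : 0 ≤ C)
    (hV : ∀ i j : Bnd n M, ‖VC n M i j‖ ≤ C * ((n : ℝ) ^ d)⁻¹ * Real.exp (-(δ * distU n M i.1 j.1)))
    (z₁ z₂ : Cen M M₀) (A : Idx n M → ℝ) :
    ‖HopS n M M₀ z₁ (Kop (DAopS n M a) (HopS n M M₀) z₂ A)‖
      ≤ thetaW d a δ C / M₀ * Real.exp (-(twoDelta0 δ M₀ * dist (ctr M M₀ z₁) (ctr M M₀ z₂))) * (‖DgS n M A‖ + ‖A‖) := by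
  have hM0 : (0 : ℝ) < M₀ := by exact_mod_cast hM₀
  have hM1 : (1 : ℝ) ≤ M₀ := by exact_mod_cast hM₀
  have hn0 : ((n : ℝ) ^ d) ≠ 0 := pow_ne_zero _ (Nat.cast_ne_zero.mpr (NeZero.ne n))
  have hs : 2 / 3 * (M₀ : ℝ) ≤ 2 * M₀ := by linarith
  have hS := schemaS_holds (a := a) hn hM₀ hδ hC hV
  have h := h128_schemaS hS hM0 hs z₁ z₂ A
  rw [HopS_eq, DAopS_eq_split]
  have eH : (HopS n M M₀) = fun z => mulOpS (hcoef n M M₀ z) := rfl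
  rw [eH]
  refine h.trans ?_
  have hE : 0 ≤ Real.exp (-(twoDelta0 δ M₀ * dist (ctr M M₀ z₁) (ctr M M₀ z₂))) := (Real.exp_pos _).le
  have hN : 0 ≤ ‖DgS n M A‖ + ‖A‖ := by positivity
  refine mul_le_mul_of_nonneg_right (mul_le_mul_of_nonneg_right ?_ hE) hN
  -- the constant is `≤ θ̄/M₀` (p38's arithmetic, verbatim)
  have hLw := Lw_nonneg d
  have hK2 := K2_nonneg
  have hK := B4Sect5Proof.latticeConst_nonneg d (le_of_lt (by positivity : (0 : ℝ) < δ / 8))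
  have h1 : (2 * d * Lw d + d * K2 + 4 * |a| * Lw d) / M₀ * Real.exp (4 + 4 / M₀)
      ≤ (2 * d * Lw d + d * K2 + 4 * |a| * Lw d) * Real.exp 8 / M₀ := by
    rw [div_mul_eq_mul_div]
    refine div_le_div_of_nonneg_right (mul_le_mul_of_nonneg_left (Real.exp_le_exp.mpr ?_) (by positivity)) hM0.le
    have : 4 / (M₀ : ℝ) ≤ 4 := div_le_self (by norm_num) hM1
    linarith
  have h2 : Lw d / M₀ * (C * ((n : ℝ) ^ d)⁻¹) * (24 / (Real.exp 1 * δ))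
        * (Fintype.card (Gr d) * (d * ((n : ℝ) ^ d * (Real.exp (2 * (δ / 8)) * B4Sect5Proof.latticeConst d (δ / 8))))) * Real.exp 7
      = Lw d * C * (24 / (Real.exp 1 * δ)) * (Fintype.card (Gr d) * (d * (Real.exp (2 * (δ / 8)) * B4Sect5Proof.latticeConst d (δ / 8))))
        * Real.exp 7 / M₀ := by
    field_simp
  rw [h2, thetaW]
  calc _ ≤ (2 * d * Lw d + d * K2 + 4 * |a| * Lw d) * Real.exp 8 / M₀
        + Lw d * C * (24 / (Real.exp 1 * δ))
          * (Fintype.card (Gr d) * (d * (Real.exp (2 * (δ / 8)) * B4Sect5Proof.latticeConst d (δ / 8)))) * Real.exp 7 / M₀ :=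
        add_le_add h1 le_rfl
    _ = _ := by rw [← add_div]

end H128

end

end Literature.MathematicalPhysics.QuantumFieldTheory.Balaban1983to89.B5SupH128Torus
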